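import Summits.QuantumFields.BalabanUV.Beta.FP.LegShiftDictionary
import Summits.QuantumFields.BalabanUV.Beta.D1BFx.ReducedKernelSandwichLeg
import Summits.QuantumFields.BalabanUV.Beta.D1BFx.PackedKernelSplit
import Summits.QuantumFields.BalabanUV.Beta.D1BFx.GhostStencilReflection

/-!
# `BalabanUV.Beta.FP.LegShiftDictionaryBlocks` — road «FP» for binder row D1, `RESIDUAL-FP` ROW #22, RULING R-FP-42, §4 OF THE DICTIONARY: THE `Fin 4`-FIBRE TWIN —
# `blk Pker tt = Ψ′·(blk Pkerˢˢ tt)` FOR THE LEG SHIFT `Ψ′ : (x, α) ↦ x − e_α` OF THE FIELD BLOCK, AND THE RELABELLING-INVARIANCE OF THE WORDS THAT `hslice` AND THE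
# (rem) LEDGER LINES OF THE ENDs ARE MADE OF (`tadpole`, `bubble`, the mixed bubble `tr((A∘V)∘(B∘W))`, `fineHessA`) — so the (U3)∕IR-5′∕ledger suppliers may work STRAIGHT

HONEST DEPENDENCY (page 1, mandatory): continuum YM on T⁴ ⇐ BetaPertH ∧ nine spine estimates (0/9 proved); BetaPertH ⇐ (D1) ∧ (D4) ∧ CAP+tail;
G-an2-4 gates asym, D1 and NE2/3/4.  HONEST FRAMING (cell contract, verbatim): «discharging `BetaPertH` makes Bałaban's UV stability UNCONDITIONAL —
a real constructive-QFT result; it is NOT the continuum limit and NOT the Clay problem.»  THIS MODULE is [folklore] kernel bookkeeping about the road's OWN typed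
objects (`refK`, `blk`, `tadpole`, `bubble`, `fineHessA`, `Pker`); no estimate of Bałaban's constrained objects, no `def`, no `def … : Prop`, nothing cited, 0 sorry; 0∕4
row-D1 binders; NOT hslice, NOT the ledger, NOT (ASYMP), NOT D1, NOT BetaPertH, NOT continuum, NOT Clay.

ABSOLUTE RULE (cell charter, verbatim): «No internally-minted statement may enter as a cited fact. Every hypothesis is either kernel-proved in this
package or a verbatim quotation of a PUBLISHED theorem with page reference. The manuscript(s) under audit are NOT citable for their own disputed
steps — they are the thing under adjudication; programme-internal (2001/route/tribunal) claims are never citable.»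

WHY (owner gen 11, R-FP-42, `FP/LegShiftDictionary` header).  The terminal END of road FP at the literal (`RoadLeftLiteralSRecord.d1Drift_JsB12Sym_of_sliceLedger_ghost_Srec`)
carries the field block `blk Pker true true` of the upper-endpoint-labelled leg in `hslice`'s leg `c m • blk Pker true true + R m` and in the seven gluon-core ledger words
`hL0`–`hL6` (which also read the gluon data through `blk (V c s) true true`, `blk (W c s e s′) true true`).  The field block of a `Fib 3`-relabelled kernel is the
`Fin 4`-relabelled field block (`blk_tt_refK`), so `blk Pker tt = Ψ′·(blk Pkerˢˢ tt)` (`refK_legShift₄_blk_PkerSwap`); and every word the END evaluates is a full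
contraction, invariant under relabelling ALL its factors (bounded legs, bi-localised jets): `KernelReflectionBounded.tadpole_refK_bdd`∕`bubble_refK_bdd` BY NAME, plus the
two-leg bubble `mixedBubble_refK_bdd` and `fineHessA_refK_bdd` here.  Hence straight slice data `(R₀, Ssl₀, Wsl₀)` at the leg `blk Pkerˢˢ tt` feed the END at
`(Ψ′·R₀, Ψ′·Ssl₀, Ψ′·Wsl₀)` with IDENTICAL word values; `Bdd` transports exactly (`bdd_refK`), `BiLoc` with constant `× e^{2δ}` (`biLoc_refK_legShift₄`).

CONTENT: §1 (any fibre, any leg map) `abs_legSign`, `bdd_refK`, **`mixedBubble_refK_bdd`**, **`fineHessA_refK_bdd`**; §2 (`Fin 4` fibre) `exists_legShift₄`, `l1_sub_unitVec_ge`,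
`biLoc_refK_legShift₄`, **`blk_tt_refK`**, **`refK_legShift₄_blk_PkerSwap`**, `blk_tt_sub`, `blk_tt_smul`.
Provenance: road FP OWNER b2b-balaban-beta-d1-p3 gen 11 (prover-b2b-balaban-beta-d1-p3-g11-0), 2026-08-21, `RESIDUAL-FP.md` §12 row #22, ruling R-FP-42.
-/

noncomputable section

namespace Summit.QuantumFields.BalabanUV.Beta.FP.LegShiftDictionaryBlocks

open Finset
open scoped BigOperators
open Literature.MathematicalPhysics.QuantumFieldTheory.Balaban1983to89
open Literature.MathematicalPhysics.QuantumFieldTheory.Balaban1983to89.Beta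
open B12Sec2to5 (l1 l1_nonneg)
open B6BondElimination (unitVec unitVec_apply)
open ExpKernelCalculus (MKer Site BiLoc comp tr bubble tadpole shiftK l1_sub_triangle)
open KernelWard (Bdd summable_slice_bdd_biLoc)
open KernelReflection (LegMap refK refK_apply comp_refK tr_refK)
open OneStepResolventKernel (Fib)
open Summit.QuantumFields.BalabanUV.Beta.FP.PerfectPolarization (Pker)
open Summit.QuantumFields.BalabanUV.Beta.FP.KernelReflectionBounded (tadpole_refK_bdd bubble_refK_bdd summable_trSlice_rl)
open Summit.QuantumFields.BalabanUV.Beta.FP.KernelWardBoundedBricks (summable_slice_rl_bdd bdd_of_rl)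
open Summit.QuantumFields.BalabanUV.Beta.D1BFx.ContactCount (abs_comp_le_of_entryBound abs_comp_le_of_rightLoc)
open Summit.QuantumFields.BalabanUV.Beta.D1BFx.PackedKernelSplit (blk blk_tt)
open Summit.QuantumFields.BalabanUV.Beta.D1BFx.ReducedKernelSandwichLeg (fineHessA fineHessA_apply)
open Summit.QuantumFields.BalabanUV.Beta.D1BFx.DressedTablesLeg (tadpoleTableA_apply bubbleTableA_apply)
open Summit.QuantumFields.BalabanUV.Beta.D1BFx.GhostStencilReflection (refK_smul refK_add)
open Summit.QuantumFields.BalabanUV.Beta.FP.LegShiftDictionary (exists_legShift refK_legShift_PkerSwap l1_unitVec)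

/-! ## §1 Relabelling invariance of the END's words — any fibre, any leg map -/

section AnyFibre

variable {D : ℕ} {F : Type*} [Fintype F] (Φ : LegMap D F)

omit [Fintype F] in
/-- [folklore] the signs of a leg map have modulus one. -/
theorem abs_legSign (a : F) : |Φ.s a| = 1 := by
  rcases mul_self_eq_one_iff.mp (Φ.s_mul_s a) with h | h <;> simp [h]

omit [Fintype F] in
/-- [folklore] **`Bdd` TRANSPORTS EXACTLY**: `Bdd K B ⟹ Bdd (Φ·K) B`. -/
theorem bdd_refK {K : MKer D F} {B : ℝ} (hK : Bdd K B) : Bdd (refK Φ K) B := by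
  intro x z a b
  rw [refK_apply, abs_mul, abs_mul, abs_legSign, abs_legSign, one_mul, one_mul]
  exact hK _ _ a b

/-- [folklore] **THE TWO-LEG BUBBLE IS RELABELLING-INVARIANT, BOUNDED LEGS**: `tr ((Φ·A ∘ Φ·V) ∘ (Φ·B ∘ Φ·W)) = tr ((A ∘ V) ∘ (B ∘ W))` for bounded `A`, `B` and vertex kernels
bi-localised at `(p,p)`, `(q,q)` (`KernelReflectionBounded.bubble_refK_bdd` with two different legs: the words of the ledger lines `hL1`∕`hL2`). -/
theorem mixedBubble_refK_bdd {A B V W : MKer D F} {Ba Bb Cv Cw δ : ℝ} (hA : Bdd A Ba) (hB : Bdd B Bb) {p q : Fin D → ℤ}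
    (hV : BiLoc V p p Cv δ) (hW : BiLoc W q q Cw δ) (hδ : 0 < δ) :
    tr (comp (comp (refK Φ A) (refK Φ V)) (comp (refK Φ B) (refK Φ W))) = tr (comp (comp A V) (comp B W)) := by
  classical
  rcases isEmpty_or_nonempty F with hF | ⟨⟨a₀⟩⟩
  · simp [ExpKernelCalculus.tr]
  have hBa : 0 ≤ Ba := (abs_nonneg _).trans (hA p p a₀ a₀)
  have hBb : 0 ≤ Bb := (abs_nonneg _).trans (hB p p a₀ a₀)
  have h1 := abs_comp_le_of_entryBound hBa hA hV hδ
  have h2 := abs_comp_le_of_entryBound hBb hB hW hδ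
  have h3 := abs_comp_le_of_rightLoc h1 h2 hδ
  rw [comp_refK Φ (summable_slice_bdd_biLoc hA hV hδ), comp_refK Φ (summable_slice_bdd_biLoc hB hW hδ),
    comp_refK Φ (summable_slice_rl_bdd h1 (bdd_of_rl h2 hδ.le) hδ)]
  exact tr_refK Φ (summable_trSlice_rl h3 hδ)

end AnyFibre

section Dim4

variable {F : Type*} [Fintype F] (Φ : LegMap 4 F)

/-- [folklore] **`fineHessA` IS RELABELLING-INVARIANT, BOUNDED LEG**: for a bounded leg `A`, a stencil family bi-localised at its base point and a pair family bi-localised at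
its two base points, `fineHessA (Φ·A) (Φ·S) (Φ·W) = fineHessA A S W` (entrywise: one tadpole, one bubble). -/
theorem fineHessA_refK_bdd {A : MKer 4 F} {S : Fin 4 → Site 4 → MKer 4 F} {W : Fin 4 → Site 4 → Fin 4 → Site 4 → MKer 4 F} {B Cs Cw δ : ℝ}
    (hA : Bdd A B) (hS : ∀ (κ : Fin 4) (u : Site 4), BiLoc (S κ u) u u Cs δ)
    (hW : ∀ (κ : Fin 4) (u : Site 4) (l : Fin 4) (u' : Site 4), BiLoc (W κ u l u') u u' Cw δ) (hδ : 0 < δ) :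
    fineHessA (refK Φ A) (fun κ u => refK Φ (S κ u)) (fun κ u l u' => refK Φ (W κ u l u')) = fineHessA A S W := by
  funext κ l u u'
  rw [fineHessA_apply, fineHessA_apply, tadpoleTableA_apply, tadpoleTableA_apply, bubbleTableA_apply, bubbleTableA_apply,
    tadpole_refK_bdd Φ hA (hW κ u l u') hδ, bubble_refK_bdd Φ hA (hS κ u) (hS l u') hδ]

end Dim4

/-! ## §2 The leg shift of the field block (`Fin 4` fibre) and `blk Pker tt = Ψ′·(blk Pkerˢˢ tt)` -/

/-- [folklore] **THE `Fin 4` LEG SHIFT EXISTS** as a `LegMap`: every leg of type `α` moved by `x ↦ x − e_α`, every sign `+1`. -/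
theorem exists_legShift₄ : ∃ Ψ' : LegMap 4 (Fin 4), (∀ (α : Fin 4) (x : Site 4), Ψ'.r α x = x - unitVec α) ∧ (∀ α : Fin 4, Ψ'.s α = 1) :=
  ⟨{ r := fun α => Equiv.subRight (unitVec α), s := fun _ => 1, s_mul_s := fun _ => one_mul 1 }, fun _ _ => rfl, fun _ => rfl⟩

/-- [folklore] a unit leg shift costs at most one in `ℓ¹`: `|x − p|₁ − 1 ≤ |x − e_α − p|₁`. -/
theorem l1_sub_unitVec_ge (α : Fin 4) (x p : Site 4) : l1 (x - p) - 1 ≤ l1 (x - unitVec α - p) := by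
  have t := l1_sub_triangle x (x - unitVec α) p
  have e : x - (x - unitVec α) = unitVec α := by abel
  rw [e, l1_unitVec] at t
  linarith

section Shift4

variable (Ψ' : LegMap 4 (Fin 4)) (hr₄ : ∀ (α : Fin 4) (x : Site 4), Ψ'.r α x = x - unitVec α) (hs₄ : ∀ α : Fin 4, Ψ'.s α = 1)

include hr₄ hs₄ in
/-- [folklore] **BI-LOCALISATION TRANSPORTS ALONG THE `Fin 4` LEG SHIFT** (constant `× e^{2δ}`, same centres, same rate, `δ ≥ 0`). -/
theorem biLoc_refK_legShift₄ {K : MKer 4 (Fin 4)} {p q : Site 4} {C δ : ℝ} (hδ : 0 ≤ δ) (hK : BiLoc K p q C δ) :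
    BiLoc (refK Ψ' K) p q (C * Real.exp (2 * δ)) δ := by
  intro x z a b
  have hC : 0 ≤ C := hK.nonneg a
  rw [refK_apply, hs₄, hs₄, one_mul, one_mul, hr₄, hr₄]
  refine (hK _ _ a b).trans ?_
  rw [mul_assoc, ← Real.exp_add]
  refine mul_le_mul_of_nonneg_left (Real.exp_le_exp.mpr ?_) hC
  have h1 := mul_le_mul_of_nonneg_left (l1_sub_unitVec_ge a x p) hδ
  have h2 := mul_le_mul_of_nonneg_left (l1_sub_unitVec_ge b z q) hδ
  linarith

include hr₄ hs₄ in
/-- [folklore] **THE FIELD BLOCK OF A `Fib 3`-RELABELLED KERNEL IS THE `Fin 4`-RELABELLED FIELD BLOCK**: `blk (Ψ·K) tt = Ψ′·(blk K tt)` whenever `Ψ` moves field legs as `Ψ′`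
does (multiplier legs of `Ψ` arbitrary). -/
theorem blk_tt_refK (Ψ : LegMap 4 (Fib 3)) (hr : ∀ (α : Fin 4) (x : Site 4), Ψ.r (Sum.inl α) x = x - unitVec α) (hs : ∀ a : Fib 3, Ψ.s a = 1)
    (K : MKer 4 (Fib 3)) : blk (refK Ψ K) true true = refK Ψ' (blk K true true) := by
  funext x z α β
  rw [blk_tt, refK_apply, refK_apply, blk_tt, hs, hs, hs₄, hs₄, hr, hr, hr₄, hr₄]

include hr₄ hs₄ in
/-- [our object] **`blk Pker tt = Ψ′·(blk Pkerˢˢ tt)`**: the field block of the leg as typed is the `Fin 4`-leg-shifted field block of the straight leg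
(`LegShiftDictionary.refK_legShift_PkerSwap` read through `blk_tt_refK`). -/
theorem refK_legShift₄_blk_PkerSwap : refK Ψ' (blk (fun x z a b => Pker z x a b) true true) = blk Pker true true := by
  obtain ⟨Ψ, hr, _, hs⟩ := exists_legShift
  rw [← blk_tt_refK Ψ' hr₄ hs₄ Ψ hr hs, refK_legShift_PkerSwap Ψ hr hs]

end Shift4

/-! ## §3 Linearity bookkeeping the END's defect words need (`Wsl − b • blk W tt`, `Ssl − a • blk V tt`, `c • blk P tt + R`) -/

/-- [folklore] the field block is additive-compatible: `blk (K − L) tt = blk K tt − blk L tt`. -/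
theorem blk_tt_sub {F : Type*} (K L : MKer 4 (F ⊕ F)) : blk (K - L) true true = blk K true true - blk L true true := by
  funext x z a b; rfl

/-- [folklore] the field block commutes with scalars: `blk (c • K) tt = c • blk K tt`. -/
theorem blk_tt_smul {F : Type*} (c : ℝ) (K : MKer 4 (F ⊕ F)) : blk (c • K) true true = c • blk K true true := by
  funext x z a b; rfl

/-- [folklore] a leg relabelling is additive on differences: `Φ·(K − L) = Φ·K − Φ·L` (any fibre). -/
theorem refK_sub₄ {F : Type*} (Φ : LegMap 4 F) (K L : MKer 4 F) : refK Φ (K - L) = refK Φ K - refK Φ L := by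
  funext x z a b
  simp only [refK_apply, Pi.sub_apply, mul_sub]

/-- [our object] **THE DRESSED LEG OF `hslice` IS THE RELABELLED STRAIGHT DRESSED LEG**: `c • blk Pker tt + Ψ′·R₀ = Ψ′·(c • blk Pkerˢˢ tt + R₀)`. -/
theorem sliceLeg_legShift₄ (Ψ' : LegMap 4 (Fin 4)) (hr₄ : ∀ (α : Fin 4) (x : Site 4), Ψ'.r α x = x - unitVec α) (hs₄ : ∀ α : Fin 4, Ψ'.s α = 1)
    (c : ℝ) (R₀ : MKer 4 (Fin 4)) :
    c • blk Pker true true + refK Ψ' R₀ = refK Ψ' (c • blk (fun x z a b => Pker z x a b) true true + R₀) := by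
  rw [refK_add, refK_smul, refK_legShift₄_blk_PkerSwap Ψ' hr₄ hs₄]

/-- [our object] **A DEFECT JET IS THE RELABELLED STRAIGHT DEFECT JET**: `Ψ′·S₀ − a • blk (Ψ·V₀) tt = Ψ′·(S₀ − a • blk V₀ tt)` (the words of `hL5`∕`hL6`; `hL4` alike with `W`). -/
theorem defectJet_legShift₄ (Ψ' : LegMap 4 (Fin 4)) (hr₄ : ∀ (α : Fin 4) (x : Site 4), Ψ'.r α x = x - unitVec α) (hs₄ : ∀ α : Fin 4, Ψ'.s α = 1)
    (Ψ : LegMap 4 (Fib 3)) (hr : ∀ (α : Fin 4) (x : Site 4), Ψ.r (Sum.inl α) x = x - unitVec α) (hs : ∀ a : Fib 3, Ψ.s a = 1)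
    (a : ℝ) (S₀ : MKer 4 (Fin 4)) (V₀ : MKer 4 (Fib 3)) :
    refK Ψ' S₀ - a • blk (refK Ψ V₀) true true = refK Ψ' (S₀ - a • blk V₀ true true) := by
  rw [refK_sub₄, refK_smul, blk_tt_refK Ψ' hr₄ hs₄ Ψ hr hs]

/-- [folklore] **THE BOUND OF A DRESSED LEG**: `Bdd P A ∧ Bdd R C ⟹ Bdd (c • P + R) (|c|·A + C)` (what `tadpole_refK_bdd`∕`bubble_refK_bdd`∕`mixedBubble_refK_bdd` ask of `hslice`'s leg). -/
theorem bdd_smul_add {F : Type*} {P R : MKer 4 F} {A C : ℝ} (c : ℝ) (hP : Bdd P A) (hR : Bdd R C) : Bdd (c • P + R) (|c| * A + C) := by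
  intro x z a b
  rw [Pi.add_apply, Pi.add_apply, Pi.add_apply, Pi.add_apply, Pi.smul_apply, Pi.smul_apply, Pi.smul_apply, Pi.smul_apply, smul_eq_mul]
  refine (abs_add_le _ _).trans (add_le_add ?_ (hR x z a b))
  rw [abs_mul]
  exact mul_le_mul_of_nonneg_left (hP x z a b) (abs_nonneg c)

end Summit.QuantumFields.BalabanUV.Beta.FP.LegShiftDictionaryBlocks

end
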